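import Summits.QuantumFields.YangMills.Theorems.UnitScaleTiltProp7KinvPiOfCone
import HarnessLib

/-!
# Route `UnitScaleTilt`, crux K1 «MinimiserStabilityRegPr» (stmt-QuantumFields-19200), EX face — K-STOREY, FILE (K5-cone, part B′ = THE SLOT-GENERIC CONE):
# **THE COARSE ENTRY ROW `hKinv` AT ANY TARGET SLOT `Δx` FROM THE ONE AT THE η-SLOT AND THE BLOCK ROW OF `G_x − G₀`** — PART B ✓`Prop7KinvPiOfCone` with the target slot a
# PARAMETER, so the J-slot `Δ₁ = DeltaOneP … a T_J` (N6-J, ★p1 g27 12:40Z: «`hKinv`(Δ₁) via … or the cone») is served by the same Neumann inverse the minute its `G₁ − G₀` rows exist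

Cell `ym3-torus` (HUMAN RULING D-0037; rung R3 = SU(2) YM₃ on T³ — NOT d = 4, NOT infinite volume, NOT a mass gap, NOT Clay).  Width seat `ym3-torus-px10` (gen 14; FREE px).
THEOREMS ONLY (0 `def`, 0 `sorry`, default heartbeats); `--supports stmt-QuantumFields-19200 --as helper`; count-neutral.

WHY.  PART B typed the cone with the Π-slot hard-coded (`DeltaPiSlotP`); nothing in its proof uses the slot beyond `PosOnto`(Δx) and the block row of the difference `GT … Δx − GT … Δ^η`
(PART B ✓`kernelRow_E_of_blockLetter` is already stated for ANY fine `B`, ✓`K_mul_KinvT`∕✓`K_add_E_eq` for any slots).  This file re-runs PART B's §3∕§4 proofs with `Δx` a variable —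
the member edition takes `Δx : GaugeField … → (BondL2K … →ₗ[ℂ] BondL2K …)`, the Idx edition `Δx : ∀ L i, GaugeField … → (…)` exactly as px10 g13's ✓`kinvRow_family_of_coercive_of_conjResolvent`.
CONSUMERS.  `Δx := DeltaPiSlotP … a` = PART B (Π-slot: `h133`, `h137kπ` via PART C); `Δx := DeltaOneP … a T_J` = the J∕Δ-slot rows `h137kΔ`, `hCk` (px10 g13's doors ✓`kernel137_family_of_kinvRow`,
✓`kernelC_family_of_kinvRow_of_greenColumn`) and `norm_H₁`, once the J-slot analogue of N6 FILE D4 (`G₁ − G₀` block rows over ✓E1∕E2) supplies `hΔb`.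
WHAT IS PROVED (ns `Summit.QuantumFields.YangMills.Theorems.Prop7KinvSlotOfCone`).
* ★★★ `kinvRow_slot_of_kinvRow_eta_of_cone` — MEMBER, any target slot `Δx`.
* ★★★ `kinvRow_slot_family_of_cone` — Idx EDITION, any slot family `Δx L i`; ONE L-only window, the ℓ's cancel.
HONEST SCOPE.  Row algebra + two operator identities (PART A∕B by name); no estimate of print is proved; nothing of `hKinv`(η)'s inputs, the difference rows' suppliers, the EX rows, EX or the
crux is proved; the Yang–Mills mass gap is NOT proved.

References: T. Bałaban, CMP **99** (1985) 389–434 [Balaban1985BackgroundPropagators] ((3.86) p.409, (3.122)–(3.126) p.420, (3.131)–(3.132) pp.421–422);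
CMP **96** (1984) 223–250 [Balaban1984PropagatorsII] (§2 (2.61) p.234); CMP **102** (1985) 277–309 [Balaban1985Variational] (Thm 1 p.279, (45)–(46) p.285).
-/

set_option autoImplicit false

noncomputable section

open scoped BigOperators Matrix.Norms.L2Operator InnerProductSpace ComplexConjugate

namespace Summit.QuantumFields.YangMills.Theorems.Prop7KinvSlotOfCone

open Literature.MathematicalPhysics.QuantumFieldTheory.Balaban1983to89
open Literature.MathematicalPhysics.QuantumFieldTheory.Balaban1983to89.T3ContinuumYM3Torus
open Literature.MathematicalPhysics.QuantumFieldTheory.Balaban1983to89.T3Thm1Carrier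
open T3PrintedRegularMinimiser (RegPr)
open T3PrintedMinimiserExistence (regPr_mono)
open T3PrintedRegularOrbits (sites_eq)
open T3LevelShift (siteShift)
open B9Eq311L2Pairing (WL2)
open B11Eq103H1Complex (BondL2K)
open B5Eq118OneStroke (iterBlockOf)
open Summit.QuantumFields.YangMills.Theorems.Prop7SectET3Transport (periodsT3)
open Summit.QuantumFields.YangMills.Theorems.Prop7SectET3HilbertLetters (W₂ toL2 toL2B)
open Summit.QuantumFields.YangMills.Theorems.Prop7SectET3WilsonHessian (DeltaEtaSlot)
open Summit.QuantumFields.YangMills.Theorems.Prop7SectET3CurvedPropagators (Qk GT KinvT PosOnto)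
open Summit.QuantumFields.YangMills.Theorems.Prop7CoarseKernelRowNeumann (kernelRow_CC_comp_CC kernelRow_CC_neg exists_inverse_CC rightInverse_eq_of_perturbation)
open Summit.QuantumFields.YangMills.Theorems.Prop7KinvPiOfCone (kernelRow_E_of_blockLetter K_mul_KinvT K_add_E_eq)

/-! ## §1 ★★★ The member at any target slot -/

section Member

variable (F : T3Family) {n K : ℕ} (h : n ≤ K) (c₀ cB : ℝ) [Fact (0 < c₀)] [Fact (0 < cB)]

/-- ★★★ **THE CONE STEP AT ANY TARGET SLOT `Δx`, MEMBER**: at `RegPr F n K ε₀ U₀` (two ε-windows), on the classes `PosOnto`(Δ^η) and `PosOnto`(Δx), the coarse entry row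
`hKinv`(η) (`C_K`, rate `μ > 0`) and the block row `hΔb` of `G_x − G₀ = GT … Δx − GT … Δ^η` (`κ`, rate `δ ≥ 2μ`) with the window `N·3(2(1+4∕μ))³ < 1`, `N = C_K·C_E·3(2(1+2∕μ))³`,
`C_E = 9600e^{2μ+1}κ(cB∕c₀)ℓ⁻³(2(1+1∕μ))³`, give the coarse entry row of `KinvT … Δx`: constant `(1∕(1 − N·3(2(1+4∕μ))³))·C_K·3(2(1+8∕μ))³`, rate `μ∕8` — PART B's
✓`kinvRow_pi_of_kinvRow_eta_of_cone` IS this at `Δx := DeltaPiSlotP … a`; at `Δx := DeltaOneP … a T_J` it is the J-slot cone (N6-J).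
[cite: Balaban1985BackgroundPropagators, (3.131)–(3.132) pp.421–422, (3.86) p.409, (3.126) p.420; Balaban1984PropagatorsII, §2] -/
theorem kinvRow_slot_of_kinvRow_eta_of_cone {ε₀ : ℝ} (hε₀ : 0 < ε₀) (hε : 10 ^ 10 * (F.L : ℝ) ^ 6 * ε₀ ≤ 1) (hε12 : 10 ^ 12 * (F.L : ℝ) ^ 3 * ε₀ ≤ 1)
    (U₀ : GaugeField (F.P K) 0 (Matrix.specialUnitaryGroup (Fin 2) ℂ)) (hreg : RegPr F n K ε₀ U₀) (a : ℝ)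
    (Δx : GaugeField (F.P K) 0 (Matrix.specialUnitaryGroup (Fin 2) ℂ) → (BondL2K ℂ 3 (periodsT3 F K) c₀ W₂ →ₗ[ℂ] BondL2K ℂ 3 (periodsT3 F K) c₀ W₂))
    (hp₀ : PosOnto F n K h c₀ cB a (DeltaEtaSlot F n K c₀) U₀) (hpx : PosOnto F n K h c₀ cB a Δx U₀)
    {CK μ κ δ : ℝ} (hCK : 0 ≤ CK) (hμ : 0 < μ) (hκ : 0 ≤ κ) (hδ : 2 * μ ≤ δ)
    (hKinv : ∀ (y : PBond (F.P n) 0) (Z : Matrix (Fin 2) (Fin 2) ℂ) (y' : PBond (F.P n) 0),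
      ‖(toL2B F n cB).symm (KinvT F n K h c₀ cB a (DeltaEtaSlot F n K c₀) U₀ (toL2B F n cB (Pi.single y Z))) y'‖
        ≤ CK * Real.exp (-(μ * (Site.tdist (P := F.P K) (siteShift (sites_eq F n K h) y'.src) (siteShift (sites_eq F n K h) y.src) : ℝ))) * ‖Z‖)
    (hΔb : ∀ (X : PBond (F.P K) 0 → Matrix (Fin 2) (Fin 2) ℂ) (z : Site (F.P K) (K - n)), (∀ b, X b ≠ 0 → iterBlockOf (K - n) b.src = z) →
      ∀ s : ℝ, 0 ≤ s → (∀ b, ‖X b‖ ≤ s) →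
        ∀ bd : PBond (F.P K) 0, ‖(toL2 F K c₀).symm ((GT F n K h c₀ cB a Δx U₀ - GT F n K h c₀ cB a (DeltaEtaSlot F n K c₀) U₀) (toL2 F K c₀ X)) bd‖
          ≤ s * κ * Real.exp (-(δ * (Site.tdist (P := F.P K) (iterBlockOf (K - n) bd.src) z : ℝ))))
    (hsmall : CK * (9600 * Real.exp (2 * μ + 1) * κ * (cB / c₀) * ((F.L : ℝ) ^ (K - n))⁻¹ ^ 3 * (2 * (1 + 1 / μ)) ^ 3) * (3 * (2 * (1 + 2 / μ)) ^ 3)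
      * (3 * (2 * (1 + 4 / μ)) ^ 3) < 1)
    (y : PBond (F.P n) 0) (Z : Matrix (Fin 2) (Fin 2) ℂ) (y' : PBond (F.P n) 0) :
    ‖(toL2B F n cB).symm (KinvT F n K h c₀ cB a Δx U₀ (toL2B F n cB (Pi.single y Z))) y'‖
      ≤ ((1 / (1 - CK * (9600 * Real.exp (2 * μ + 1) * κ * (cB / c₀) * ((F.L : ℝ) ^ (K - n))⁻¹ ^ 3 * (2 * (1 + 1 / μ)) ^ 3) * (3 * (2 * (1 + 2 / μ)) ^ 3)
            * (3 * (2 * (1 + 4 / μ)) ^ 3))) * CK * (3 * (2 * (1 + 8 / μ)) ^ 3))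
          * Real.exp (-(μ / 8 * (Site.tdist (P := F.P K) (siteShift (sites_eq F n K h) y'.src) (siteShift (sites_eq F n K h) y.src) : ℝ))) * ‖Z‖ := by
  classical
  have hc₀ : 0 < c₀ := Fact.out
  have hcB : 0 < cB := Fact.out
  have hL0 : (0 : ℝ) < F.L := by exact_mod_cast lt_trans zero_lt_one F.hL.2
  haveI : FiniteDimensional ℂ (WL2 ℂ (fun _ : PBond (F.P n) 0 => cB) W₂) := LinearEquiv.finiteDimensional (toL2B F n cB)
  -- the letters of the cone
  set Q := Qk F n K h c₀ cB U₀ with hQ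
  set Gη := GT F n K h c₀ cB a (DeltaEtaSlot F n K c₀) U₀ with hGη
  set Gπ := GT F n K h c₀ cB a Δx U₀ with hGπ
  set Uη := KinvT F n K h c₀ cB a (DeltaEtaSlot F n K c₀) U₀ with hUη
  set Uπ := KinvT F n K h c₀ cB a Δx U₀ with hUπ
  set E : WL2 ℂ (fun _ : PBond (F.P n) 0 => cB) W₂ →ₗ[ℂ] WL2 ℂ (fun _ : PBond (F.P n) 0 => cB) W₂ := Q ∘ₗ ((Gπ - Gη) ∘ₗ LinearMap.adjoint Q) with hE
  set CE : ℝ := 9600 * Real.exp (2 * μ + 1) * κ * (cB / c₀) * ((F.L : ℝ) ^ (K - n))⁻¹ ^ 3 * (2 * (1 + 1 / μ)) ^ 3 with hCE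
  have hCE0 : 0 ≤ CE := by rw [hCE]; positivity
  -- conversions of the volume factors
  have e2 : (2 * (1 + 1 / (μ / 2))) = 2 * (1 + 2 / μ) := by field_simp
  have e4 : (2 * (1 + 1 / (μ / 2 - μ / 4))) = 2 * (1 + 4 / μ) := by field_simp; ring
  have e8 : (2 * (1 + 1 / (μ / 8))) = 2 * (1 + 8 / μ) := by field_simp
  -- (2) the row of `E` at rate `μ`
  have hErow : ∀ (y : PBond (F.P n) 0) (Z : Matrix (Fin 2) (Fin 2) ℂ) (y' : PBond (F.P n) 0),
      ‖(toL2B F n cB).symm (E (toL2B F n cB (Pi.single y Z))) y'‖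
        ≤ CE * Real.exp (-(μ * (Site.tdist (P := F.P K) (siteShift (sites_eq F n K h) y'.src) (siteShift (sites_eq F n K h) y.src) : ℝ))) * ‖Z‖ := by
    intro y Z y'
    rw [hE, LinearMap.comp_apply]
    exact kernelRow_E_of_blockLetter F h c₀ cB hε₀ hε hε12 U₀ hreg (Gπ - Gη) hκ hμ hδ hΔb y Z y'
  -- (3) the row of `B := Uη ∘ E` at rate `μ∕2`
  have hBrow := kernelRow_CC_comp_CC F h cB Uη E (r := μ / 2) (ν := μ / 2) hCK hCE0 (by positivity) (by linarith) (by positivity) (by linarith) hKinv hErow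
  rw [e2] at hBrow
  -- (4) the Neumann inverse of `1 + Uη ∘ E` at rate `μ∕4`
  set N : ℝ := CK * CE * (3 * (2 * (1 + 2 / μ)) ^ 3) with hN
  have hN0 : 0 ≤ N := by rw [hN]; positivity
  have hsmall' : N * (3 * (2 * (1 + 1 / (μ / 2 - μ / 4))) ^ 3) < 1 := by rw [e4, hN, hCE]; exact hsmall
  obtain ⟨W, hW1, hW2, hWrow⟩ := exists_inverse_CC F h cB (-(Uη ∘ₗ E)) (C := N) (μ := μ / 2) (r := μ / 4) hN0 (by positivity) (by linarith) hsmall'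
    (kernelRow_CC_neg F h cB (Uη ∘ₗ E) hBrow)
  rw [e4] at hWrow
  -- (5) the identification `Uπ = W ∘ Uη`
  have hK₀ : (Q ∘ₗ (Gη ∘ₗ LinearMap.adjoint Q)) * Uη = 1 := K_mul_KinvT F h c₀ cB a _ U₀ hp₀
  have hKπ : (Q ∘ₗ (Gη ∘ₗ LinearMap.adjoint Q) + E) * Uπ = 1 := by
    rw [hE, K_add_E_eq F h c₀ cB a]
    exact K_mul_KinvT F h c₀ cB a _ U₀ hpx
  have hW1' : (1 + Uη * E) * W = 1 := by
    have : (1 : WL2 ℂ (fun _ : PBond (F.P n) 0 => cB) W₂ →ₗ[ℂ] WL2 ℂ (fun _ : PBond (F.P n) 0 => cB) W₂) - -(Uη ∘ₗ E) = 1 + Uη * E := by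
      rw [sub_neg_eq_add]; rfl
    rw [← this]; exact hW1
  have hid : Uπ = W * Uη := rightInverse_eq_of_perturbation hK₀ hW1' hKπ
  -- (6) the row of `W ∘ Uη` at rate `μ∕8`
  have hfin := kernelRow_CC_comp_CC F h cB W Uη (r := μ / 8) (ν := μ / 8) (by rw [hN]; exact div_nonneg one_pos.le (by linarith)) hCK
    (by positivity) (by linarith) (by positivity) (by linarith) hWrow hKinv y Z y'
  rw [e8] at hfin
  have happ : Uπ (toL2B F n cB (Pi.single y Z)) = (W ∘ₗ Uη) (toL2B F n cB (Pi.single y Z)) := by rw [hid]; rfl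
  rw [happ]
  refine hfin.trans (le_of_eq ?_)
  rw [hN, hCE]

end Member

/-! ## §2 ★★★ The Idx edition at any slot family -/

section Family

/-- ★★★ **THE CONE STEP AT ANY TARGET SLOT FAMILY `Δx L i`, Idx EDITION**: cap `α` with the two windows of record; L-only weights `c₀ cB`; member couplings `a L i`; slots `Δx L i`; ANY thread `Λ`;
the classes `PosOnto`(Δ^η)∕`PosOnto`(Δx L i) under the thread; `hKinv`(η) at the scaling of record `CK L·((c₀ L∕cB L)·ℓ³)`, rate `μ L > 0`; the block row of `GT (Δx L i) − GT Δ^η` with an L-only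
`κ L` at rate `δ L ≥ 2μ L`; ONE L-only window (the ℓ's CANCEL) ⟹ the doors' `hKinv` FAMILY TEXT at `Δx L i` with `CK L := (1∕(1 − window))·CK L·3(2(1+8∕μ L))³`, rate `μ L∕8` — PART B's
✓`kinvRow_pi_family_of_cone` IS this at `Δx L i := DeltaPiSlotP … (a L i)`. [cite: Balaban1985BackgroundPropagators, (3.131)–(3.132) pp.421–422, (3.86) p.409; Balaban1985Variational, Thm 1 p.279] -/
theorem kinvRow_slot_family_of_cone
    (α : ℕ → ℝ) (hα : ∀ L : ℕ, 1 < L → 0 < α L) (hW : ∀ L : ℕ, 1 < L → 10 ^ 10 * (L : ℝ) ^ 6 * α L ≤ 1) (hW' : ∀ L : ℕ, 1 < L → 10 ^ 12 * (L : ℝ) ^ 3 * α L ≤ 1)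
    (c₀ cB : ℕ → ℝ) [hc₀ : ∀ L : ℕ, Fact (0 < c₀ L)] [hcB : ∀ L : ℕ, Fact (0 < cB L)] (a : ∀ L : ℕ, Idx L → ℝ)
    (Δx : ∀ (L : ℕ) (i : Idx L), GaugeField (i.1.1.P i.1.2.2) 0 (Matrix.specialUnitaryGroup (Fin 2) ℂ) →
      (BondL2K ℂ 3 (periodsT3 i.1.1 i.1.2.2) (c₀ L) W₂ →ₗ[ℂ] BondL2K ℂ 3 (periodsT3 i.1.1 i.1.2.2) (c₀ L) W₂))
    (Λ : ∀ (L : ℕ) (i : Idx L), GaugeField (i.1.1.P i.1.2.2) 0 (Matrix.specialUnitaryGroup (Fin 2) ℂ) → Prop)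
    (hposη : ∀ (L : ℕ), 1 < L → ∀ (i : Idx L) (U₀ : GaugeField (i.1.1.P i.1.2.2) 0 (Matrix.specialUnitaryGroup (Fin 2) ℂ)), ∀ ρ : ℝ, RegPr i.1.1 i.1.2.1 i.1.2.2 ρ U₀ → ρ ≤ α L →
      Λ L i U₀ → PosOnto i.1.1 i.1.2.1 i.1.2.2 i.2.2.le (c₀ L) (cB L) (a L i) (DeltaEtaSlot i.1.1 i.1.2.1 i.1.2.2 (c₀ L)) U₀)
    (hpos : ∀ (L : ℕ), 1 < L → ∀ (i : Idx L) (U₀ : GaugeField (i.1.1.P i.1.2.2) 0 (Matrix.specialUnitaryGroup (Fin 2) ℂ)), ∀ ρ : ℝ, RegPr i.1.1 i.1.2.1 i.1.2.2 ρ U₀ → ρ ≤ α L →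
      Λ L i U₀ → PosOnto i.1.1 i.1.2.1 i.1.2.2 i.2.2.le (c₀ L) (cB L) (a L i) (Δx L i) U₀)
    (CK μ κ δ : ℕ → ℝ) (hCK : ∀ L, 1 < L → 0 ≤ CK L) (hμ : ∀ L, 1 < L → 0 < μ L) (hκ : ∀ L, 1 < L → 0 ≤ κ L) (hδ : ∀ L, 1 < L → 2 * μ L ≤ δ L)
    (hKinv : ∀ (L : ℕ), 1 < L → ∀ (i : Idx L) (U₀ : GaugeField (i.1.1.P i.1.2.2) 0 (Matrix.specialUnitaryGroup (Fin 2) ℂ)), ∀ ρ : ℝ, RegPr i.1.1 i.1.2.1 i.1.2.2 ρ U₀ → ρ ≤ α L →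
      Λ L i U₀ → ∀ (y : PBond (i.1.1.P i.1.2.1) 0) (Z : Matrix (Fin 2) (Fin 2) ℂ) (y' : PBond (i.1.1.P i.1.2.1) 0),
        ‖(toL2B i.1.1 i.1.2.1 (cB L)).symm (KinvT i.1.1 i.1.2.1 i.1.2.2 i.2.2.le (c₀ L) (cB L) (a L i) (DeltaEtaSlot i.1.1 i.1.2.1 i.1.2.2 (c₀ L)) U₀
            (toL2B i.1.1 i.1.2.1 (cB L) (Pi.single y Z))) y'‖
          ≤ CK L * ((c₀ L / cB L) * ((L : ℝ) ^ (i.1.2.2 - i.1.2.1)) ^ 3)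
              * Real.exp (-(μ L * (Site.tdist (siteShift (sites_eq i.1.1 i.1.2.1 i.1.2.2 i.2.2.le) y'.src) (siteShift (sites_eq i.1.1 i.1.2.1 i.1.2.2 i.2.2.le) y.src) : ℝ))) * ‖Z‖)
    (hΔb : ∀ (L : ℕ), 1 < L → ∀ (i : Idx L) (U₀ : GaugeField (i.1.1.P i.1.2.2) 0 (Matrix.specialUnitaryGroup (Fin 2) ℂ)), ∀ ρ : ℝ, RegPr i.1.1 i.1.2.1 i.1.2.2 ρ U₀ → ρ ≤ α L →
      Λ L i U₀ → ∀ (X : PBond (i.1.1.P i.1.2.2) 0 → Matrix (Fin 2) (Fin 2) ℂ) (z : Site (i.1.1.P i.1.2.2) (i.1.2.2 - i.1.2.1)),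
        (∀ b, X b ≠ 0 → iterBlockOf (i.1.2.2 - i.1.2.1) b.src = z) → ∀ s : ℝ, 0 ≤ s → (∀ b, ‖X b‖ ≤ s) →
          ∀ bd : PBond (i.1.1.P i.1.2.2) 0, ‖(toL2 i.1.1 i.1.2.2 (c₀ L)).symm ((GT i.1.1 i.1.2.1 i.1.2.2 i.2.2.le (c₀ L) (cB L) (a L i)
              (Δx L i) U₀ - GT i.1.1 i.1.2.1 i.1.2.2 i.2.2.le (c₀ L) (cB L) (a L i) (DeltaEtaSlot i.1.1 i.1.2.1 i.1.2.2 (c₀ L)) U₀)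
              (toL2 i.1.1 i.1.2.2 (c₀ L) X)) bd‖
            ≤ s * κ L * Real.exp (-(δ L * (Site.tdist (P := i.1.1.P i.1.2.2) (iterBlockOf (i.1.2.2 - i.1.2.1) bd.src) z : ℝ))))
    (hwin : ∀ L, 1 < L → CK L * (9600 * Real.exp (2 * μ L + 1) * κ L * (2 * (1 + 1 / μ L)) ^ 3) * (3 * (2 * (1 + 2 / μ L)) ^ 3) * (3 * (2 * (1 + 4 / μ L)) ^ 3) < 1) :
    ∀ (L : ℕ), 1 < L → ∀ (i : Idx L) (U₀ : GaugeField (i.1.1.P i.1.2.2) 0 (Matrix.specialUnitaryGroup (Fin 2) ℂ)), ∀ ρ : ℝ, RegPr i.1.1 i.1.2.1 i.1.2.2 ρ U₀ → ρ ≤ α L →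
      Λ L i U₀ → ∀ (y : PBond (i.1.1.P i.1.2.1) 0) (Z : Matrix (Fin 2) (Fin 2) ℂ) (y' : PBond (i.1.1.P i.1.2.1) 0),
        ‖(toL2B i.1.1 i.1.2.1 (cB L)).symm (KinvT i.1.1 i.1.2.1 i.1.2.2 i.2.2.le (c₀ L) (cB L) (a L i) (Δx L i) U₀
            (toL2B i.1.1 i.1.2.1 (cB L) (Pi.single y Z))) y'‖
          ≤ ((1 / (1 - CK L * (9600 * Real.exp (2 * μ L + 1) * κ L * (2 * (1 + 1 / μ L)) ^ 3) * (3 * (2 * (1 + 2 / μ L)) ^ 3) * (3 * (2 * (1 + 4 / μ L)) ^ 3)))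
              * CK L * (3 * (2 * (1 + 8 / μ L)) ^ 3)) * ((c₀ L / cB L) * ((L : ℝ) ^ (i.1.2.2 - i.1.2.1)) ^ 3)
              * Real.exp (-(μ L / 8 * (Site.tdist (siteShift (sites_eq i.1.1 i.1.2.1 i.1.2.2 i.2.2.le) y'.src) (siteShift (sites_eq i.1.1 i.1.2.1 i.1.2.2 i.2.2.le) y.src) : ℝ))) * ‖Z‖ := by
  intro L hL i U₀ ρ hreg hρ hl y Z y'
  have hFL : (i.1.1.L : ℝ) = (L : ℝ) := by rw [i.2.1]
  have hc₀L : 0 < c₀ L := (hc₀ L).out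
  have hcBL : 0 < cB L := (hcB L).out
  have hL0 : (0 : ℝ) < (L : ℝ) := by exact_mod_cast lt_trans zero_lt_one hL
  have hℓ : (0 : ℝ) < (L : ℝ) ^ (i.1.2.2 - i.1.2.1) := pow_pos hL0 _
  have hregα : RegPr i.1.1 i.1.2.1 i.1.2.2 (α L) U₀ := regPr_mono (F := i.1.1) hρ hreg
  have hεw : 10 ^ 10 * (i.1.1.L : ℝ) ^ 6 * α L ≤ 1 := by rw [hFL]; exact hW L hL
  have hεw' : 10 ^ 12 * (i.1.1.L : ℝ) ^ 3 * α L ≤ 1 := by rw [hFL]; exact hW' L hL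
  -- the scaling of record `t = (c₀∕cB)ℓ³` cancels against `C_E`'s `(cB∕c₀)ℓ⁻³`
  set t : ℝ := (c₀ L / cB L) * ((L : ℝ) ^ (i.1.2.2 - i.1.2.1)) ^ 3 with ht
  have ht0 : 0 < t := by rw [ht]; positivity
  have hCKt : 0 ≤ CK L * t := mul_nonneg (hCK L hL) ht0.le
  have hkey : CK L * t * (9600 * Real.exp (2 * μ L + 1) * κ L * (cB L / c₀ L) * ((i.1.1.L : ℝ) ^ (i.1.2.2 - i.1.2.1))⁻¹ ^ 3 * (2 * (1 + 1 / μ L)) ^ 3)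
      = CK L * (9600 * Real.exp (2 * μ L + 1) * κ L * (2 * (1 + 1 / μ L)) ^ 3) := by
    rw [hFL, ht]
    field_simp
  have hsmall : CK L * t * (9600 * Real.exp (2 * μ L + 1) * κ L * (cB L / c₀ L) * ((i.1.1.L : ℝ) ^ (i.1.2.2 - i.1.2.1))⁻¹ ^ 3 * (2 * (1 + 1 / μ L)) ^ 3)
      * (3 * (2 * (1 + 2 / μ L)) ^ 3) * (3 * (2 * (1 + 4 / μ L)) ^ 3) < 1 := by
    rw [hkey]; exact hwin L hL
  have hmem := kinvRow_slot_of_kinvRow_eta_of_cone i.1.1 i.2.2.le (c₀ L) (cB L) (hα L hL) hεw hεw' U₀ hregα (a L i) (Δx L i)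
    (hposη L hL i U₀ ρ hreg hρ hl) (hpos L hL i U₀ ρ hreg hρ hl) hCKt (hμ L hL) (hκ L hL) (hδ L hL)
    (hKinv L hL i U₀ ρ hreg hρ hl) (hΔb L hL i U₀ ρ hreg hρ hl) hsmall y Z y'
  refine hmem.trans (le_of_eq ?_)
  congr 1
  congr 1
  rw [hkey]
  set D : ℝ := 1 / (1 - CK L * (9600 * Real.exp (2 * μ L + 1) * κ L * (2 * (1 + 1 / μ L)) ^ 3) * (3 * (2 * (1 + 2 / μ L)) ^ 3) * (3 * (2 * (1 + 4 / μ L)) ^ 3))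
  ring

end Family

end Summit.QuantumFields.YangMills.Theorems.Prop7KinvSlotOfCone

end
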